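import Literature.NumberTheory.Automorphic.HarishChandraModuleIntertwiners
import HarnessLib

/-!
# Crux `H413` — RUNG 1½ «ISOTYPY FROM A NULL CORE», brick B5a: TRANSLATE DETECTION — a non-zero closed `G`-invariant subspace of an
# irreducible `P` detects every non-zero vector through the translates by the commuting complement

Floor-0 programme P3 «U3-mult», seat F0P3-p02 (g3); crux item stmt-HodgeConjecture-24833 (`HCCMUnconditional.H413`); road doc
`F0/P3/F0P3-p02/ROAD-F1a-inhouse.F0P3p02g3.md` (B1 ★ `F0P3GenIrreducibleOfUnitary`, B2 ★ `HarishChandraModuleIntertwiners`, B3 ★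
`F0P3LieSpanClosureInvariant` ∕ `F0P3HolFormClosedSubrep`, B4 ★ `F0P3GenClosureKFinite` ∕ `F0P3HolFormGenClasses`).  HC_CM is proved only modulo
the printed citations until rung 0 closes.

GENERIC setting = the standing data of letter F1a ★ `DiscreteAutomorphicRep.ArchIsotypy`: a discrete automorphic `P` of `G(𝔸_K)` (topologically
IRREDUCIBLE closed invariant subspace of `L²`), a real matrix group `G` with `ιG : G →* G(𝔸_K)`, and a subgroup `C ≤ G(𝔸_K)` commuting with
`ιG(G)` such that `G(𝔸_K) = ιG(G) · C` (the `hfac` hypothesis; at the CM pin ★ `F0P3ArchIsotypyCM.hfac_cmArchSectionUForm`).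

* `isUnitary_toContRep`, `toContRep_archRep_comm` — `P(c)`, `c ∈ C`, is unitary and commutes with `P|_G`; hence (`starProjection_translate_archRep_comm`)
  so does `p_W ∘ P(c⁻¹)` for every closed `P|_G`-invariant `W` (★ `DiscreteAutomorphicRep.starProjection_archRep`).
* **`exists_starProjection_translate_ne_zero`** — if `W ≠ ⊥` then for every `v ≠ 0` in `P` some `p_W (P(c⁻¹) v)`, `c ∈ C`, is non-zero: otherwise
  `v ⊥ P(c) W` for all `c`, and the closed span of the `P(c) W` is `G(𝔸_K)`-invariant (`ιG(u)` permutes nothing: `P(ιG u) P(c) W = P(c) W`), closed,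
  non-zero, hence all of `P` by irreducibility — so `v ⊥ v`.
* **`exists_gkMap_ne_zero_of_closedSubrep`** — consequently every non-zero smooth `K`-finite vector `v ∈ P.archModule G ιG` is DETECTED INSIDE `W`
  by a `(𝔤, K)`-endomorphism of the archimedean module with values in `W` (the Harish-Chandra map ★ `Intertwiner.harishChandraMap` of
  `p_W ∘ P(c⁻¹)`, ★ `archRepK_map` ∕ `archRepLie_map`): the separating family of letter F1a, modulo identifying the smooth `K`-finite vectors of
  `W` with ONE irreducible admissible module (B4 at the CM pin for `W = C_Φ`).

No definition, no sorry, no named fact; `--supports stmt-HodgeConjecture-24833 --as helper`.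

References: [Dixmier1977] §13.1.2 (projections in the commutant), §13.1.8; [BorelJacquetCorvallis1979] §4.3, §4.6 (restriction to a factor);
[FlathCorvallis1979] Thm. 3–4; [BorelWallach2000] 0 §2.4.
-/

set_option linter.dupNamespace false

-- Mathlib idiom (Mathlib/Algebra/Lie/OfAssociative.lean; as in ★ `HarishChandraModuleIntertwiners`): the commutator bracket on `Module.End ℂ V`,
-- needed to MENTION `G.lie →ₗ⁅ℝ⁆ Module.End ℂ _` (`P.archRepLie`).
attribute [local instance 100] LieRing.ofAssociativeRing

open MeasureTheory NumberField
open scoped InnerProductSpace Matrix.Norms.Operator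

universe u

namespace Summit.HodgeConjecture.HodgeConjecture.Cruxes.H413.F0P3TranslateDetection

open Literature.NumberTheory.Automorphic

variable {K : Type} [Field K] [NumberField K] {𝒢 : AdelicGroupData.{u} K}
  {μ : Measure 𝒢.automorphicQuotient} [𝒢.IsAutomorphicMeasure μ]
  {A : Type*} [NormedCommRing A] [NormedAlgebra ℝ A] [NormedAlgebra ℚ A] [CompleteSpace A]
  [StarRing A] {N : Type*} [Fintype N] [DecidableEq N]
  (P : DiscreteAutomorphicRep 𝒢 μ) (G : RealMatrixGroup A N) (ιG : G.carrier →* 𝒢.Adelic)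

/-! ## §1 The translates `P(c)`, `c ∈ C`: unitary, commuting with `P|_G` -/

omit [𝒢.IsAutomorphicMeasure μ] in
/-- `P(g)` (the action of `G(𝔸_K)` on the closed invariant subspace `P ⊂ L²`) is unitary (★ `isUnitary_rightRegular`). [cite: BorelJacquetCorvallis1979, §4.6] -/
theorem isUnitary_toContRep [SMulInvariantMeasure 𝒢.Adelic 𝒢.automorphicQuotient μ] (P : DiscreteAutomorphicRep 𝒢 μ) :
    P.space.toContRep.IsUnitary := by
  intro g
  have hu : IsUnit (P.space.toContRep g) := (Group.isUnit g).map P.space.toContRep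
  refine hu.mem_unitary_of_star_mul_self ((P.space.toContRep g).norm_map_iff_adjoint_comp_self.mp fun x => ?_)
  change ‖((𝒢.rightRegular μ g (x : 𝒢.L2 μ)) : 𝒢.L2 μ)‖ = ‖(x : 𝒢.L2 μ)‖
  exact (𝒢.isUnitary_rightRegular μ).norm_map g (x : 𝒢.L2 μ)

/-- `P(c)` commutes with `P|_G` when `c` commutes with `ιG(G)`. [cite: BorelJacquetCorvallis1979, §4.3] -/
theorem toContRep_archRep_comm {c : 𝒢.Adelic} (hc : ∀ u : G.carrier, ιG u * c = c * ιG u) (u : G.carrier) (v : P.space.toSubmodule) :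
    P.space.toContRep c (P.archRep G ιG u v) = P.archRep G ιG u (P.space.toContRep c v) := by
  rw [P.archRep_apply]
  change (P.space.toContRep c * P.space.toContRep (ιG u)) v = (P.space.toContRep (ιG u) * P.space.toContRep c) v
  rw [← map_mul, ← map_mul, hc u]

/-- `P(c⁻¹) P(c) = 1 = P(c) P(c⁻¹)` on vectors. [folklore] -/
theorem toContRep_inv_apply (c : 𝒢.Adelic) (v : P.space.toSubmodule) : P.space.toContRep c⁻¹ (P.space.toContRep c v) = v := by
  change (P.space.toContRep c⁻¹ * P.space.toContRep c) v = v
  rw [← map_mul, inv_mul_cancel, map_one]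
  rfl

/-- `P(c) P(c⁻¹) = 1` on vectors. [folklore] -/
theorem toContRep_apply_inv (c : 𝒢.Adelic) (v : P.space.toSubmodule) : P.space.toContRep c (P.space.toContRep c⁻¹ v) = v := by
  simpa only [inv_inv] using toContRep_inv_apply P c⁻¹ v

/-- For a closed `P|_G`-invariant subspace `W` and `c` commuting with `ιG(G)`, the bounded operator `p_W ∘ P(c⁻¹)` commutes with `P|_G`
(★ `starProjection_archRep`). [cite: Dixmier1977, §13.1.2] -/
theorem starProjection_translate_archRep_comm (W : ContRepresentation.ClosedSubrep (P.archRep G ιG)) {c : 𝒢.Adelic}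
    (hc : ∀ u : G.carrier, ιG u * c = c * ιG u) (u : G.carrier) (v : P.space.toSubmodule) :
    (W.toSubmodule.starProjection ∘L P.space.toContRep c⁻¹) (P.archRep G ιG u v) =
      P.archRep G ιG u ((W.toSubmodule.starProjection ∘L P.space.toContRep c⁻¹) v) := by
  have hc' : ∀ u : G.carrier, ιG u * c⁻¹ = c⁻¹ * ιG u := fun u => by
    rw [← mul_inv_eq_iff_eq_mul.2 ((mul_assoc _ _ _).trans ((congrArg (c⁻¹ * ·) (hc u)).trans
      (by rw [← mul_assoc, inv_mul_cancel, one_mul]))).symm]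
  rw [ContinuousLinearMap.comp_apply, ContinuousLinearMap.comp_apply, toContRep_archRep_comm P G ιG hc' u v,
    P.starProjection_archRep G ιG W u]

/-! ## §2 A non-zero closed `G`-invariant subspace detects every non-zero vector through the translates -/

/-- **Translate detection.**  `G(𝔸_K) = ιG(G) · C` with `C` commuting with `ιG(G)`, `W ≠ ⊥` a closed `P|_G`-invariant subspace: for every
`v ≠ 0` in `P` there is `c ∈ C` with `p_W (P(c⁻¹) v) ≠ 0`.  (Else `v ⊥ P(c) W` for all `c ∈ C`; the closed span of these translates is
`G(𝔸_K)`-invariant — `P(ιG u · c') P(c) W = P(c' c) P(ιG u) W ⊆ P(c' c) W` — closed and `⊇ W ≠ 0`, so it is `P` by irreducibility, and `v ⊥ v`.)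
[cite: Dixmier1977, §13.1.2 and §13.1.8] [cite: BorelJacquetCorvallis1979, §4.6] -/
theorem exists_starProjection_translate_ne_zero {C : Subgroup 𝒢.Adelic}
    (hC : ∀ (u : G.carrier) (c : 𝒢.Adelic), c ∈ C → ιG u * c = c * ιG u)
    (hgen : ∀ g : 𝒢.Adelic, ∃ (u : G.carrier) (c : 𝒢.Adelic), c ∈ C ∧ g = ιG u * c)
    (W : ContRepresentation.ClosedSubrep (P.archRep G ιG)) (hW : W ≠ ⊥) {v : P.space.toSubmodule} (hv : v ≠ 0) :
    ∃ c ∈ C, W.toSubmodule.starProjection (P.space.toContRep c⁻¹ v) ≠ 0 := by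
  by_contra! h
  have hU := isUnitary_toContRep P
  -- `v` is orthogonal to every translate `P(c) W`, `c ∈ C`
  have horth : ∀ c ∈ C, ∀ w ∈ W.toSubmodule, ⟪P.space.toContRep c w, v⟫_ℂ = 0 := by
    intro c hc w hw
    have h1 : P.space.toContRep c⁻¹ v ∈ W.toSubmoduleᗮ := (Submodule.starProjection_apply_eq_zero_iff _).1 (h c hc)
    have h2 : ⟪w, P.space.toContRep c⁻¹ v⟫_ℂ = 0 := h1 w hw
    rwa [← hU.inner_map_map c, toContRep_apply_inv] at h2
  -- the span of the translates and its closure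
  let S : Submodule ℂ P.space.toSubmodule :=
    Submodule.span ℂ {x | ∃ c ∈ C, ∃ w ∈ W.toSubmodule, x = P.space.toContRep c w}
  have hSv : S ≤ (Submodule.span ℂ {v})ᗮ := by
    refine Submodule.span_le.2 ?_
    rintro _ ⟨c, hc, w, hw, rfl⟩
    exact (Submodule.mem_orthogonal_singleton_iff_inner_left).2 (horth c hc w hw)
  have hSinv : ∀ (g : 𝒢.Adelic), ∀ x ∈ S, P.space.toContRep g x ∈ S := by
    intro g x hx
    obtain ⟨u, c', hc', rfl⟩ := hgen g
    have hmap : S.map (P.space.toContRep (ιG u * c') : P.space.toSubmodule →ₗ[ℂ] P.space.toSubmodule) ≤ S := by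
      rw [Submodule.map_span]
      refine Submodule.span_mono ?_
      rintro _ ⟨_, ⟨c, hc, w, hw, rfl⟩, rfl⟩
      refine ⟨c' * c, C.mul_mem hc' hc, P.archRep G ιG u w, W.apply_mem u hw, ?_⟩
      change (P.space.toContRep (ιG u * c') * P.space.toContRep c) w = (P.space.toContRep (c' * c) * P.space.toContRep (ιG u)) w
      rw [← map_mul, ← map_mul, mul_assoc, hC u (c' * c) (C.mul_mem hc' hc)]
    exact hmap ⟨x, hx, rfl⟩
  let D : ContRepresentation.ClosedSubrep P.space.toContRep :=
    { toSubmodule := S.topologicalClosure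
      apply_mem_toSubmodule := fun g x hx => by
        have hx' : (x : P.space.toSubmodule) ∈ closure (S : Set P.space.toSubmodule) := by
          rwa [← Submodule.topologicalClosure_coe]
        have h1 : P.space.toContRep g x ∈ closure ((P.space.toContRep g) '' (S : Set P.space.toSubmodule)) :=
          image_closure_subset_closure_image (P.space.toContRep g).continuous ⟨x, hx', rfl⟩
        have h2 : (P.space.toContRep g) '' (S : Set P.space.toSubmodule) ⊆ S := by
          rintro _ ⟨y, hy, rfl⟩
          exact hSinv g y hy
        have h3 := closure_mono h2 h1
        rwa [← Submodule.topologicalClosure_coe] at h3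
      isClosed' := S.isClosed_topologicalClosure }
  haveI : IsSimpleOrder (ContRepresentation.ClosedSubrep P.space.toContRep) := P.irreducible
  rcases eq_bot_or_eq_top D with hD | hD
  · -- `W ≤ D = ⊥`
    apply hW
    refine ContRepresentation.ClosedSubrep.ext fun x => ⟨fun hx => ?_, fun hx => ?_⟩
    · have hxS : x ∈ S := Submodule.subset_span ⟨1, C.one_mem, x, hx, by rw [map_one]; rfl⟩
      have hxD : x ∈ D := S.le_topologicalClosure hxS
      rw [hD] at hxD
      exact hxD
    · rw [ContRepresentation.ClosedSubrep.mem_bot] at hx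
      rw [hx]
      exact W.toSubmodule.zero_mem
  · -- `v ∈ D = ⊤` and `v ⊥ D`
    have hvD : v ∈ D := by rw [hD]; exact ContRepresentation.ClosedSubrep.mem_top v
    have hcl : S.topologicalClosure ≤ (Submodule.span ℂ {v})ᗮ :=
      S.topologicalClosure_minimal hSv (Submodule.isClosed_orthogonal _)
    have hvv : ⟪v, v⟫_ℂ = 0 := (Submodule.mem_orthogonal_singleton_iff_inner_left).1 (hcl hvD)
    exact hv (inner_self_eq_zero.1 hvv)

/-! ## §3 Detection of the archimedean module inside `W` by `(𝔤, K)`-maps -/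

/-- **Every non-zero smooth `K`-finite vector is detected INSIDE `W` by a `(𝔤, K)`-endomorphism of the archimedean module** — the
Harish-Chandra map of `p_W ∘ P(c⁻¹)` for the `c ∈ C` of `exists_starProjection_translate_ne_zero` (★ `Intertwiner.harishChandraMap`,
★ `archRepK_map`, ★ `archRepLie_map`): `K`-equivariant, `𝔤`-equivariant, with values in `W`, the identity composed with `P(c⁻¹)` on `W`, non-zero at `v`.
[cite: Dixmier1977, §13.1.2] [cite: BorelWallach2000, 0 §2.4 and §3.1] [cite: FlathCorvallis1979, Thm. 3 and Thm. 4] -/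
theorem exists_gkMap_ne_zero_of_closedSubrep [FiniteDimensional ℝ A] (hι : Continuous ιG) {C : Subgroup 𝒢.Adelic}
    (hC : ∀ (u : G.carrier) (c : 𝒢.Adelic), c ∈ C → ιG u * c = c * ιG u)
    (hgen : ∀ g : 𝒢.Adelic, ∃ (u : G.carrier) (c : 𝒢.Adelic), c ∈ C ∧ g = ιG u * c)
    (W : ContRepresentation.ClosedSubrep (P.archRep G ιG)) (hW : W ≠ ⊥) {v : P.archModule G ιG} (hv : v ≠ 0) :
    ∃ (c : 𝒢.Adelic) (_ : c ∈ C) (φ : P.archModule G ιG →ₗ[ℂ] P.archModule G ιG),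
      (∀ (k : G.maximalCompact) (w : P.archModule G ιG), φ (P.archRepK G ιG k w) = P.archRepK G ιG k (φ w)) ∧
      (∀ (X : G.lie) (w : P.archModule G ιG), φ (P.archRepLie G ιG hι X w) = P.archRepLie G ιG hι X (φ w)) ∧
      (∀ w : P.archModule G ιG, ((φ w : P.archModule G ιG) : P.space.toSubmodule) ∈ W) ∧
      (∀ w : P.archModule G ιG, ((φ w : P.archModule G ιG) : P.space.toSubmodule) =
        W.toSubmodule.starProjection (P.space.toContRep c⁻¹ (w : P.space.toSubmodule))) ∧
      φ v ≠ 0 := by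
  have hv' : (v : P.space.toSubmodule) ≠ 0 := fun h => hv (Subtype.ext h)
  obtain ⟨c, hc, hne⟩ := exists_starProjection_translate_ne_zero P G ιG hC hgen W hW hv'
  have hT := starProjection_translate_archRep_comm P G ιG W (fun u => hC u c hc)
  refine ⟨c, hc, Intertwiner.harishChandraMap G hT, fun k w => P.archRepK_map G ιG hT k w,
    fun X w => P.archRepLie_map G ιG hT hι X w, fun w => ?_, fun w => rfl, ?_⟩
  · change (W.toSubmodule.starProjection ∘L P.space.toContRep c⁻¹) (w : P.space.toSubmodule) ∈ W.toSubmodule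
    rw [ContinuousLinearMap.comp_apply]
    exact W.toSubmodule.starProjection_apply_mem _
  · exact Intertwiner.harishChandraMap_apply_ne_zero G hT hne

end Summit.HodgeConjecture.HodgeConjecture.Cruxes.H413.F0P3TranslateDetection
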